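import Mathlib
import Summits.MatrixMultiplication.MatrixMultiplication.Theorems.LieRankDesigns.Negative.Basics

/-!
# `LieRankDesigns` (stmt-MatrixMultiplication-7614), line `Sketch`: stub F `stub_budgetGlue` — the budget glue `A → B → C → D → E → CellBudget`

Crux `Summit.MatrixMultiplication.MatrixMultiplication.Theses.LevelGradedCohnUmans.LieRankDesigns`; skeleton
`Cruxes/LieRankDesigns/Lines/Sketch.lean` (lead prover-line-stmt-MatrixMultiplication-7614-0, 7 registered stubs A–G);
this file proves the registered stub `stub_budgetGlue` verbatim (name + signature) and lands
`--supports stmt-MatrixMultiplication-7614`.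

Content. `G = GL_m(𝔽_p)`, `1 ≤ k ≤ m`, `S = Irr(G) ∩ F_k`, `budget_s = Σ_{χ ∈ S} χ(1)^s`.  With the
subgroups `H ≤ Z ≤ P` of hypothesis B (frame stabiliser, its central extension, the parabolic) and an
irreducible `ρ` on `V` with character `χ ∈ S`, `d = dim V`:
* `dim V^H · |H| = Σ_{h ∈ H} χ(h)` (averaging projection, Mathlib
  `Representation.card_inv_mul_sum_char_eq_finrank`), which is `≠ 0` by A, so `V^H ≠ 0`;
* `V^H` is `P`-stable (`H ⊴ P`), so C gives the WALL PIECE `d ≤ [G:P] · dim V^H`;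
* an irreducible `P`-piece `θ ≤ V^H` is `H`-trivial, so E (with `[P, Z] ⊆ H`) gives `dim(θ)² ≤ [P:Z]`,
  and C again gives the DEGREE PIECE `d ≤ [G:P] · dim θ ≤ [G:P] · √[P:Z]`;
* summing `d^s = d^{s-2} · d · d ≤ ([G:P]√[P:Z])^{s-2} · [G:P] · d · dim V^H` over `S` and comparing with
  D (`Σ_{Irr} χ(1) Σ_H χ = |G|`, all terms `≥ 0`) gives `budget_s ≤ ([G:P]√[P:Z])^{s-2} [G:P] [G:H]`;
* B's counts `[G:P] ≤ 2^m p^{k(m-k)}`, `[G:H] ≤ p^{mk}`, `[P:Z](p-1) ≤ p^{k²}` then give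
  `budget_s · (p-1)^{(s-2)/2} ≤ 2^{m(s-1)} p^{(mk - k²/2)s}` (real-exponent bookkeeping).
-/

set_option linter.dupNamespace false

noncomputable section

open scoped BigOperators
open Literature.RepresentationTheory.FiniteGroups
open Summit.MatrixMultiplication.MatrixMultiplication.Theorems.LieRankDesigns.Negative
  (GLm Mat fourierFn RankSupp RankSep levelSet budget volume)

namespace Summit.MatrixMultiplication.MatrixMultiplication.Theorems.LieRankDesigns

namespace BudgetGlue

open Module

/-! ### Finite sums over subgroups -/

/-- The `finsum` over the inlined frame-stabiliser set is the finite sum over the frame stabiliser `H`.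
[folklore] -/
-- adapted from `LevelFixedVector.finsum_mem_setOf_eq_sum` (stub A of this line)
theorem finsum_mem_setOf_eq_sum {p m : ℕ} [Fact p.Prime] {k : ℕ} (H : Subgroup (GLm p m)) [Fintype H]
    (hH : ∀ h : GLm p m, h ∈ H ↔ ∀ i j : Fin m, (i : ℕ) < k → (h : Mat p m) j i = (1 : Mat p m) j i)
    (f : GLm p m → ℂ) :
    ∑ᶠ h ∈ {h : GLm p m | ∀ i j : Fin m, (i : ℕ) < k → (h : Mat p m) j i = (1 : Mat p m) j i}, f h =
      ∑ h : H, f h := by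
  rw [finsum_mem_eq_finite_toFinset_sum f (Set.toFinite _)]
  exact Finset.sum_subtype _ (fun h => by rw [Set.Finite.mem_toFinset, Set.mem_setOf_eq, hH]) f

/-- The `finsum` over the carrier of a subgroup of a finite group is the finite sum over the subgroup.
[folklore] -/
theorem finsum_mem_coe_eq_sum {G : Type} [Group G] [Fintype G] (H : Subgroup G) [Fintype H]
    (f : G → ℂ) : ∑ᶠ h ∈ (H : Set G), f h = ∑ h : H, f h := by
  rw [finsum_mem_eq_finite_toFinset_sum f (Set.toFinite _)]
  exact Finset.sum_subtype _ (fun h => by rw [Set.Finite.mem_toFinset, SetLike.mem_coe]) f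

/-! ### Invariants of a subgroup: averaging and stability -/

/-- **Averaging projection**: `Σ_{h ∈ H} χ_ρ(h) = dim V^H · |H|` for the restriction of `ρ` to a
subgroup `H` (Mathlib `Representation.card_inv_mul_sum_char_eq_finrank`). [folklore] -/
theorem sum_character_eq {G : Type} [Group G] (H : Subgroup G) [Fintype H] {V : Type}
    [AddCommGroup V] [Module ℂ V] [FiniteDimensional ℂ V] (ρ : Representation ℂ G V) :
    ∑ h : H, ρ.character h =
      (finrank ℂ (Representation.invariants (ρ.comp H.subtype)) : ℂ) * (Fintype.card H : ℂ) := by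
  have hne : (Nat.card H : ℂ) ≠ 0 := Nat.cast_ne_zero.mpr (Nat.card_pos (α := H)).ne'
  haveI : Invertible (Nat.card H : ℂ) := invertibleOfNonzero hne
  have key := Representation.card_inv_mul_sum_char_eq_finrank (ρ.comp H.subtype)
  have hchar : ∀ g : H, Representation.character (ρ.comp H.subtype) g = ρ.character g := fun g => rfl
  simp only [hchar] at key
  rw [(inv_mul_eq_iff_eq_mul₀ hne).mp key, Nat.card_eq_fintype_card, mul_comm]

/-- The `H`-invariants of `ρ` are stable under `ρ(g)` for `g` in a subgroup `P` normalising `H`: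
`ρ(h) ρ(g) v = ρ(g) ρ(g⁻¹ h g) v = ρ(g) v`. [folklore] -/
theorem map_invariants_le {G : Type} [Group G] {V : Type} [AddCommGroup V] [Module ℂ V]
    (ρ : Representation ℂ G V) (H P : Subgroup G) (hnorm : ∀ g ∈ P, ∀ h ∈ H, g * h * g⁻¹ ∈ H)
    {g : G} (hg : g ∈ P) :
    (Representation.invariants (ρ.comp H.subtype)).map (ρ g) ≤
      Representation.invariants (ρ.comp H.subtype) := by
  intro x hx
  obtain ⟨v, hv, rfl⟩ := Submodule.mem_map.mp hx
  rw [Representation.mem_invariants] at hv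
  rw [Representation.mem_invariants]
  intro h
  have hh : g⁻¹ * h * g ∈ H := by
    have := hnorm g⁻¹ (P.inv_mem hg) h h.2
    rwa [inv_inv] at this
  have key : ρ (g⁻¹ * h * g) v = v := hv ⟨g⁻¹ * h * g, hh⟩
  change ρ (h : G) (ρ g v) = ρ g v
  calc ρ (h : G) (ρ g v) = ρ (g * (g⁻¹ * h * g)) v := by
        rw [← Module.End.mul_apply, ← map_mul]
        congr 2
        group
    _ = ρ g (ρ (g⁻¹ * h * g) v) := by rw [map_mul, Module.End.mul_apply]
    _ = ρ g v := by rw [key]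

/-! ### The two degree bounds (wall piece and degree piece) -/

/-- **Degree bounds.** For subgroups `H, Z, P ≤ G` with `P` normalising `H` and `[P, Z] ⊆ H` (only
`[P:Z] = [P : Z ∩ P]` enters), the orbit-span bound (C), the central degree bound (E), and an irreducible
`ρ` on `V` with `V^H ≠ 0`: `dim V ≤ [G:P] · dim V^H` (C applied to the `P`-stable `V^H`) and
`(dim V)² ≤ [G:P]² · [P:Z]` (C applied to an irreducible `P`-piece `θ ≤ V^H`, which is `H`-trivial, so
`dim(θ)² · |Z ∩ P| ≤ |P|` by E). [folklore] -/
theorem degree_bounds {G : Type} [Group G] [Fintype G]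
    (hC : ∀ (G : Type) [Group G] [Fintype G] (V : Type) [AddCommGroup V] [Module ℂ V]
      [FiniteDimensional ℂ V] (ρ : Representation ℂ G V), ρ.IsIrreducible →
      ∀ (P : Subgroup G) (W : Submodule ℂ V), W ≠ ⊥ → (∀ g ∈ P, W.map (ρ g) ≤ W) →
        Module.finrank ℂ V ≤ P.index * Module.finrank ℂ W)
    (hE : ∀ (P : Type) [Group P] [Fintype P] (H Z : Subgroup P),
      (∀ g : P, ∀ z ∈ Z, g * z * g⁻¹ * z⁻¹ ∈ H) →
      ∀ (W : Type) [AddCommGroup W] [Module ℂ W] [FiniteDimensional ℂ W] (θ : Representation ℂ P W),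
        θ.IsIrreducible → (∀ h ∈ H, θ h = LinearMap.id) →
          Module.finrank ℂ W ^ 2 * Nat.card Z ≤ Nat.card P)
    (H Z P : Subgroup G)
    (hnorm : ∀ g ∈ P, ∀ h ∈ H, g * h * g⁻¹ ∈ H)
    (hcomm : ∀ g ∈ P, ∀ z ∈ Z, g * z * g⁻¹ * z⁻¹ ∈ H)
    {V : Type} [AddCommGroup V] [Module ℂ V] [FiniteDimensional ℂ V]
    (ρ : Representation ℂ G V) (hρ : ρ.IsIrreducible)
    (hne : (Representation.invariants (ρ.comp H.subtype)) ≠ ⊥) :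
    finrank ℂ V ≤ P.index * finrank ℂ (Representation.invariants (ρ.comp H.subtype)) ∧
      (finrank ℂ V) ^ 2 ≤ P.index ^ 2 * Z.relIndex P := by
  classical
  have hstab : ∀ g ∈ P, (Representation.invariants (ρ.comp H.subtype)).map (ρ g) ≤
      Representation.invariants (ρ.comp H.subtype) := fun g hg => map_invariants_le ρ H P hnorm hg
  refine ⟨hC G V ρ hρ P _ hne hstab, ?_⟩
  -- the restriction of `ρ|_P` to `V^H`, a representation `θ₀` of `P`
  set VH : Submodule ℂ V := (Representation.invariants (ρ.comp H.subtype)) with hVH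
  let SP : Subrepresentation (ρ.comp P.subtype) :=
    ⟨VH, fun g v hv => hstab g g.2 (Submodule.mem_map_of_mem hv)⟩
  let θ₀ : Representation ℂ P VH := SP.toRepresentation
  haveI : Nontrivial VH := Submodule.nontrivial_iff_ne_bot.mpr hne
  -- an irreducible `P`-piece `q ≤ V^H`
  obtain ⟨q, hq, hqirr⟩ := Representation.exists_ne_bot_isIrreducible θ₀
  -- it is `H`-trivial
  have hHtriv : ∀ h ∈ H.subgroupOf P, q.toRepresentation h = LinearMap.id := by
    intro h hh
    rw [Subgroup.mem_subgroupOf] at hh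
    refine LinearMap.ext fun w => Subtype.ext (Subtype.ext ?_)
    change ρ (h : G) ((w : VH) : V) = ((w : VH) : V)
    exact (Representation.mem_invariants _ _).mp (w : VH).2 ⟨(h : G), hh⟩
  -- the commutator hypothesis inside `P`
  have hcommP : ∀ g : P, ∀ z ∈ Z.subgroupOf P, g * z * g⁻¹ * z⁻¹ ∈ H.subgroupOf P := by
    intro g z hz
    rw [Subgroup.mem_subgroupOf] at hz ⊢
    rw [Subgroup.coe_mul, Subgroup.coe_mul, Subgroup.coe_mul, Subgroup.coe_inv, Subgroup.coe_inv]
    exact hcomm g g.2 z hz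
  have hEq :=
    hE P (H.subgroupOf P) (Z.subgroupOf P) hcommP q.toSubmodule q.toRepresentation hqirr hHtriv
  -- `q`, seen in `V`, is a non-zero `P`-stable subspace
  set W : Submodule ℂ V := q.toSubmodule.map VH.subtype with hW
  have hWne : W ≠ ⊥ := by
    intro h0
    apply hq
    have h1 : q.toSubmodule = ⊥ :=
      Submodule.map_injective_of_injective VH.injective_subtype (h0.trans (Submodule.map_bot _).symm)
    exact Subrepresentation.toSubmodule_injective (by rw [h1]; rfl)
  have hWstab : ∀ g ∈ P, W.map (ρ g) ≤ W := by
    intro g hg x hx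
    obtain ⟨y, hy, rfl⟩ := Submodule.mem_map.mp hx
    obtain ⟨w, hw, rfl⟩ := Submodule.mem_map.mp hy
    exact Submodule.mem_map.mpr ⟨θ₀ ⟨g, hg⟩ w, q.apply_mem_toSubmodule ⟨g, hg⟩ hw, rfl⟩
  have h1 := hC G V ρ hρ P W hWne hWstab
  rw [hW, Submodule.finrank_map_subtype_eq] at h1
  -- count: `dim(q)² · |Z| ≤ |P| = [P:Z] · |Z|`
  have hcard : Nat.card (Z.subgroupOf P) * Z.relIndex P = Nat.card P := by
    rw [Subgroup.relIndex]
    exact Subgroup.card_mul_index _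
  have h2 : finrank ℂ q.toSubmodule ^ 2 ≤ Z.relIndex P := by
    refine Nat.le_of_mul_le_mul_right ?_ (Nat.card_pos (α := Z.subgroupOf P))
    calc finrank ℂ q.toSubmodule ^ 2 * Nat.card (Z.subgroupOf P) ≤ Nat.card P := hEq
      _ = Z.relIndex P * Nat.card (Z.subgroupOf P) := by rw [mul_comm, hcard]
  calc finrank ℂ V ^ 2 ≤ (P.index * finrank ℂ q.toSubmodule) ^ 2 := Nat.pow_le_pow_left h1 2
    _ = P.index ^ 2 * finrank ℂ q.toSubmodule ^ 2 := mul_pow _ _ _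
    _ ≤ P.index ^ 2 * Z.relIndex P := Nat.mul_le_mul_left _ h2

/-! ### Real-exponent bookkeeping -/

/-- Per-character estimate: from `0 < d ≤ [G:P] · a` and `d² ≤ [G:P]² · r`,
`d^s ≤ ([G:P] √r)^{s-2} · ([G:P] / |H|) · (d · (a · |H|))` for `s ≥ 2`. [folklore] -/
theorem rpow_degree_bound {d a iP r cH s : ℝ} (hd : 0 < d) (hiP : 0 ≤ iP) (hcH : 0 < cH)
    (h1 : d ≤ iP * a) (h2 : d ^ 2 ≤ iP ^ 2 * r) (hs : 2 ≤ s) :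
    d ^ s ≤ (iP * Real.sqrt r) ^ (s - 2) * (iP / cH) * (d * (a * cH)) := by
  have hdle : d ≤ iP * Real.sqrt r := by
    calc d = Real.sqrt (d ^ 2) := (Real.sqrt_sq hd.le).symm
      _ ≤ Real.sqrt (iP ^ 2 * r) := Real.sqrt_le_sqrt h2
      _ = iP * Real.sqrt r := by rw [Real.sqrt_mul (sq_nonneg _), Real.sqrt_sq hiP]
  calc d ^ s = d ^ (s - 2) * d ^ (2 : ℝ) := by rw [← Real.rpow_add hd]; congr 1; ring
    _ = d ^ (s - 2) * (d * d) := by rw [Real.rpow_two, sq]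
    _ ≤ (iP * Real.sqrt r) ^ (s - 2) * ((iP * a) * d) :=
        mul_le_mul (Real.rpow_le_rpow hd.le hdle (by linarith))
          (mul_le_mul_of_nonneg_right h1 hd.le) (by positivity) (by positivity)
    _ = (iP * Real.sqrt r) ^ (s - 2) * (iP / cH) * (d * (a * cH)) := by
        field_simp

/-- Final assembly of the cell budget from `budget ≤ ([G:P]√[P:Z])^{s-2} [G:P] [G:H]` and the parabolic
counts `[G:P] ≤ 2^m q^{k(m-k)}`, `[G:H] ≤ q^{mk}`, `[P:Z](q-1) ≤ q^{k²}`: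
`budget · (q-1)^{(s-2)/2} ≤ 2^{m(s-1)} q^{(mk-k²/2)s}`. [folklore] -/
theorem final_bound {B iP iH r q s : ℝ} {m k : ℕ} (hkm : k ≤ m) (hs : 2 ≤ s) (hq : 2 ≤ q)
    (hiP0 : 0 ≤ iP) (hiH0 : 0 ≤ iH) (hr0 : 0 ≤ r)
    (hB : B ≤ (iP * Real.sqrt r) ^ (s - 2) * (iP * iH))
    (hPi : iP ≤ 2 ^ m * q ^ (k * (m - k))) (hHi : iH ≤ q ^ (m * k))
    (hZi : r * (q - 1) ≤ q ^ (k ^ 2)) :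
    B * (q - 1) ^ ((s - 2) / 2) ≤
      2 ^ ((m : ℝ) * (s - 1)) * q ^ (((m : ℝ) * k - (k : ℝ) ^ 2 / 2) * s) := by
  have hq0 : 0 < q := by linarith
  have hq1 : 0 ≤ q - 1 := by linarith
  set e : ℝ := (m : ℝ) * k - (k : ℝ) ^ 2 / 2 with he
  -- the parabolic counts in `rpow` form
  have hPi' : iP ≤ (2 : ℝ) ^ (m : ℝ) * q ^ ((k : ℝ) * ((m : ℝ) - k)) := by
    calc iP ≤ 2 ^ m * q ^ (k * (m - k)) := hPi
      _ = (2 : ℝ) ^ (m : ℝ) * q ^ ((k : ℝ) * ((m : ℝ) - k)) := by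
        rw [← Real.rpow_natCast 2 m, ← Real.rpow_natCast q (k * (m - k))]
        push_cast [Nat.cast_sub hkm]; ring_nf
  have hHi' : iH ≤ q ^ ((m : ℝ) * k) := by
    calc iH ≤ q ^ (m * k) := hHi
      _ = q ^ ((m : ℝ) * k) := by rw [← Real.rpow_natCast q (m * k)]; push_cast; ring_nf
  have hZi' : r * (q - 1) ≤ q ^ ((k : ℝ) ^ 2) := by
    calc r * (q - 1) ≤ q ^ (k ^ 2) := hZi
      _ = q ^ ((k : ℝ) ^ 2) := by rw [← Real.rpow_natCast q (k ^ 2)]; push_cast; ring_nf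
  -- `X = [G:P] √([P:Z](q-1)) ≤ 2^m q^e` and `Y = [G:P][G:H] ≤ 2^m q^{2e}`
  have hX : iP * (Real.sqrt r * Real.sqrt (q - 1)) ≤ (2 : ℝ) ^ (m : ℝ) * q ^ e := by
    have h1 : Real.sqrt r * Real.sqrt (q - 1) ≤ q ^ ((k : ℝ) ^ 2 / 2) := by
      rw [← Real.sqrt_mul hr0]
      calc Real.sqrt (r * (q - 1)) ≤ Real.sqrt (q ^ ((k : ℝ) ^ 2)) := Real.sqrt_le_sqrt hZi'
        _ = q ^ ((k : ℝ) ^ 2 / 2) := by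
          rw [Real.sqrt_eq_rpow, ← Real.rpow_mul hq0.le]; congr 1; ring
    calc iP * (Real.sqrt r * Real.sqrt (q - 1))
        ≤ ((2 : ℝ) ^ (m : ℝ) * q ^ ((k : ℝ) * ((m : ℝ) - k))) * q ^ ((k : ℝ) ^ 2 / 2) :=
          mul_le_mul hPi' h1 (by positivity) (by positivity)
      _ = (2 : ℝ) ^ (m : ℝ) * q ^ e := by
          rw [mul_assoc, ← Real.rpow_add hq0]; congr 2; rw [he]; ring
  have hY : iP * iH ≤ (2 : ℝ) ^ (m : ℝ) * q ^ (2 * e) := by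
    calc iP * iH ≤ ((2 : ℝ) ^ (m : ℝ) * q ^ ((k : ℝ) * ((m : ℝ) - k))) * q ^ ((m : ℝ) * k) :=
          mul_le_mul hPi' hHi' hiH0 (by positivity)
      _ = (2 : ℝ) ^ (m : ℝ) * q ^ (2 * e) := by
          rw [mul_assoc, ← Real.rpow_add hq0]; congr 2; rw [he]; ring
  -- assemble
  have hsq : (q - 1) ^ ((s - 2) / 2) = Real.sqrt (q - 1) ^ (s - 2) := by
    rw [Real.sqrt_eq_rpow, ← Real.rpow_mul hq1]; congr 1; ring
  calc B * (q - 1) ^ ((s - 2) / 2)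
      ≤ (iP * Real.sqrt r) ^ (s - 2) * (iP * iH) * (q - 1) ^ ((s - 2) / 2) :=
        mul_le_mul_of_nonneg_right hB (Real.rpow_nonneg hq1 _)
    _ = (iP * (Real.sqrt r * Real.sqrt (q - 1))) ^ (s - 2) * (iP * iH) := by
        rw [hsq, Real.mul_rpow hiP0 (Real.sqrt_nonneg _),
          Real.mul_rpow hiP0 (mul_nonneg (Real.sqrt_nonneg _) (Real.sqrt_nonneg _)),
          Real.mul_rpow (Real.sqrt_nonneg _) (Real.sqrt_nonneg _)]
        ring
    _ ≤ ((2 : ℝ) ^ (m : ℝ) * q ^ e) ^ (s - 2) * ((2 : ℝ) ^ (m : ℝ) * q ^ (2 * e)) :=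
        mul_le_mul (Real.rpow_le_rpow (by positivity) hX (by linarith)) hY (by positivity)
          (by positivity)
    _ = 2 ^ ((m : ℝ) * (s - 1)) * q ^ (e * s) := by
        rw [Real.mul_rpow (by positivity) (by positivity), ← Real.rpow_mul (by norm_num),
          ← Real.rpow_mul hq0.le, mul_mul_mul_comm, ← Real.rpow_add (by norm_num),
          ← Real.rpow_add hq0]
        congr 2 <;> ring

end BudgetGlue

open Module BudgetGlue in
/-- **Stub F `BudgetGlue`** (registered signature): hypotheses A `LevelFixedVector`, B `ParabolicFacts`,
C `OrbitSpanBound`, D `RegularCount`, E `CentralDegreeBound` imply `CellBudget`: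
for `1 ≤ k ≤ m`, `s ≥ 2`, `budget_s · (p-1)^{(s-2)/2} ≤ 2^{m(s-1)} p^{(mk - k²/2)s}`.
Proof: for `χ = χ_ρ ∈ Irr ∩ F_k`, `V^H ≠ 0` (A and the averaging projection), so
`d ≤ [G:P] dim V^H` and `d² ≤ [G:P]² [P:Z]` (`degree_bounds`, from C and E); hence
`d^s ≤ ([G:P]√[P:Z])^{s-2} [G:P] |H|⁻¹ · χ(1) Σ_H χ`, and summing with D (all terms `≥ 0`) gives
`budget_s ≤ ([G:P]√[P:Z])^{s-2} [G:P] [G:H]`; B's counts finish (`final_bound`). -/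
theorem stub_budgetGlue :
    (∀ (p m k : ℕ) [Fact p.Prime], 1 ≤ k → k ≤ m →
      ∀ χ ∈ irrChars (GLm p m) ∩ levelSet p m k,
        (∑ᶠ h ∈ {h : GLm p m | ∀ i j : Fin m, (i : ℕ) < k → (h : Mat p m) j i = (1 : Mat p m) j i}, χ h) ≠ 0) →
    (∀ (p m k : ℕ) [Fact p.Prime], 1 ≤ k → k ≤ m →
      ∃ H Z P : Subgroup (GLm p m),
        (∀ h : GLm p m, h ∈ H ↔ ∀ i j : Fin m, (i : ℕ) < k → (h : Mat p m) j i = (1 : Mat p m) j i) ∧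
        H ≤ Z ∧ Z ≤ P ∧
        (∀ g ∈ P, ∀ h ∈ H, g * h * g⁻¹ ∈ H) ∧
        (∀ g ∈ P, ∀ z ∈ Z, g * z * g⁻¹ * z⁻¹ ∈ H) ∧
        (P.index : ℝ) ≤ 2 ^ m * (p : ℝ) ^ (k * (m - k)) ∧
        (H.index : ℝ) ≤ (p : ℝ) ^ (m * k) ∧
        (Z.relIndex P : ℝ) * ((p : ℝ) - 1) ≤ (p : ℝ) ^ (k ^ 2)) →
    (∀ (G : Type) [Group G] [Fintype G] (V : Type) [AddCommGroup V] [Module ℂ V] [FiniteDimensional ℂ V]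
      (ρ : Representation ℂ G V), ρ.IsIrreducible →
      ∀ (P : Subgroup G) (W : Submodule ℂ V), W ≠ ⊥ → (∀ g ∈ P, W.map (ρ g) ≤ W) →
        Module.finrank ℂ V ≤ P.index * Module.finrank ℂ W) →
    (∀ (G : Type) [Group G] [Fintype G] (H : Subgroup G),
      ∑ᶠ χ ∈ irrChars G, χ 1 * ∑ᶠ h ∈ (H : Set G), χ h = (Fintype.card G : ℂ)) →
    (∀ (P : Type) [Group P] [Fintype P] (H Z : Subgroup P),
      (∀ g : P, ∀ z ∈ Z, g * z * g⁻¹ * z⁻¹ ∈ H) →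
      ∀ (W : Type) [AddCommGroup W] [Module ℂ W] [FiniteDimensional ℂ W] (θ : Representation ℂ P W),
        θ.IsIrreducible → (∀ h ∈ H, θ h = LinearMap.id) →
          Module.finrank ℂ W ^ 2 * Nat.card Z ≤ Nat.card P) →
    ∀ (p m k : ℕ) [Fact p.Prime], 1 ≤ k → k ≤ m → ∀ s : ℝ, 2 ≤ s →
      budget p m k s * ((p : ℝ) - 1) ^ ((s - 2) / 2) ≤
        2 ^ ((m : ℝ) * (s - 1)) * (p : ℝ) ^ (((m : ℝ) * k - (k : ℝ) ^ 2 / 2) * s) := by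
  intro hA hB hC hD hE p m k _ hk hkm s hs
  classical
  obtain ⟨H, Z, P, hHmem, -, -, hnorm, hcomm, hPi, hHi, hZi⟩ := hB p m k hk hkm
  -- the two finite index sets
  have hfinI : (irrChars (GLm p m)).Finite := irrChars_finite_holds (GLm p m)
  have hfinS : (irrChars (GLm p m) ∩ levelSet p m k).Finite := hfinI.subset Set.inter_subset_left
  have hsub : hfinS.toFinset ⊆ hfinI.toFinset :=
    Set.Finite.toFinset_subset_toFinset.mpr Set.inter_subset_left
  -- every irreducible character has `χ(1) = d ∈ ℕ` and `Σ_H χ = n · |H|`, `n ∈ ℕ`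
  have hreal : ∀ χ ∈ irrChars (GLm p m), ∃ d n : ℕ,
      χ 1 = d ∧ ∑ h : H, χ h = (n : ℂ) * (Fintype.card H : ℂ) := by
    intro χ hχ
    obtain ⟨V, _, _, _, ρ, -, rfl⟩ := id hχ
    exact ⟨finrank ℂ V, finrank ℂ (Representation.invariants (ρ.comp H.subtype)), ρ.char_one,
      sum_character_eq H ρ⟩
  -- D: `Σ_{Irr} χ(1) · Σ_H χ = |G|`, real parts
  have hDsum : ∑ χ ∈ hfinI.toFinset, (χ 1).re * (∑ h : H, χ h).re = (Fintype.card (GLm p m) : ℝ) := by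
    have h := hD (GLm p m) H
    rw [finsum_mem_eq_finite_toFinset_sum _ hfinI] at h
    simp only [finsum_mem_coe_eq_sum H] at h
    have h' := congrArg Complex.re h
    rw [Complex.re_sum, Complex.natCast_re] at h'
    rw [← h']
    refine Finset.sum_congr rfl fun χ hχ => ?_
    obtain ⟨d, n, hd, hn⟩ := hreal χ (hfinI.mem_toFinset.mp hχ)
    rw [hd, hn]
    simp only [Complex.mul_re, Complex.natCast_re, Complex.natCast_im, mul_zero, sub_zero, zero_mul]
  -- constants
  have hcH : (0 : ℝ) < (Fintype.card H : ℝ) := Nat.cast_pos.mpr Fintype.card_pos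
  have hiP0 : (0 : ℝ) ≤ (P.index : ℝ) := Nat.cast_nonneg _
  set K : ℝ := ((P.index : ℝ) * Real.sqrt (Z.relIndex P : ℝ)) ^ (s - 2) *
    ((P.index : ℝ) / (Fintype.card H : ℝ)) with hK
  have hK0 : 0 ≤ K := by positivity
  -- the per-character estimate on `S`
  have hterm : ∀ χ ∈ hfinS.toFinset, (χ 1).re ^ s ≤ K * ((χ 1).re * (∑ h : H, χ h).re) := by
    intro χ hχS
    have hχ : χ ∈ irrChars (GLm p m) ∩ levelSet p m k := hfinS.mem_toFinset.mp hχS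
    have hAχ : ∑ h : H, χ h ≠ 0 := by
      have := hA p m k hk hkm χ hχ
      rwa [finsum_mem_setOf_eq_sum H hHmem χ] at this
    obtain ⟨V, _, _, _, ρ, hρ, rfl⟩ := id hχ.1
    have hsumeq := sum_character_eq H ρ
    have hne : (Representation.invariants (ρ.comp H.subtype)) ≠ ⊥ := by
      intro hbot
      apply hAχ
      rw [hsumeq, Submodule.finrank_eq_zero.mpr hbot, Nat.cast_zero, zero_mul]
    obtain ⟨h1, h2⟩ := degree_bounds hC hE H Z P hnorm hcomm ρ hρ hne
    have hd : (ρ.character 1).re = (finrank ℂ V : ℝ) := by rw [ρ.char_one, Complex.natCast_re]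
    have hσ : (∑ h : H, ρ.character h).re =
        (finrank ℂ (Representation.invariants (ρ.comp H.subtype)) : ℝ) * (Fintype.card H : ℝ) := by
      rw [hsumeq]
      simp only [Complex.mul_re, Complex.natCast_re, Complex.natCast_im, mul_zero, sub_zero]
    have h1' : (finrank ℂ V : ℝ) ≤
        (P.index : ℝ) * (finrank ℂ (Representation.invariants (ρ.comp H.subtype)) : ℝ) := by
      exact_mod_cast h1
    have h2' : (finrank ℂ V : ℝ) ^ 2 ≤ (P.index : ℝ) ^ 2 * (Z.relIndex P : ℝ) := by exact_mod_cast h2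
    have hdpos : (0 : ℝ) < (finrank ℂ V : ℝ) := by
      have h0 : finrank ℂ (Representation.invariants (ρ.comp H.subtype)) ≠ 0 := fun h0 =>
        hne (Submodule.finrank_eq_zero.mp h0)
      have hle := Submodule.finrank_le (Representation.invariants (ρ.comp H.subtype))
      exact_mod_cast (Nat.pos_of_ne_zero h0).trans_le hle
    rw [hd, hσ]
    exact rpow_degree_bound hdpos hiP0 hcH h1' h2' hs
  -- the terms off `S` are `≥ 0`
  have hnonneg : ∀ χ ∈ hfinI.toFinset, χ ∉ hfinS.toFinset → 0 ≤ (χ 1).re * (∑ h : H, χ h).re := by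
    intro χ hχ _
    obtain ⟨d, n, hd, hn⟩ := hreal χ (hfinI.mem_toFinset.mp hχ)
    rw [hd, hn]
    simp only [Complex.mul_re, Complex.natCast_re, Complex.natCast_im, mul_zero, sub_zero]
    positivity
  -- `budget ≤ ([G:P]√[P:Z])^{s-2} [G:P] [G:H]`
  have hbud : budget p m k s ≤ ((P.index : ℝ) * Real.sqrt (Z.relIndex P : ℝ)) ^ (s - 2) *
      ((P.index : ℝ) * (H.index : ℝ)) := by
    have hbudget : budget p m k s = ∑ χ ∈ hfinS.toFinset, (χ 1).re ^ s := by
      unfold budget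
      exact finsum_mem_eq_finite_toFinset_sum _ hfinS
    have hGH : (Fintype.card (GLm p m) : ℝ) = (Fintype.card H : ℝ) * (H.index : ℝ) := by
      rw [← Nat.card_eq_fintype_card, ← Subgroup.card_mul_index H, Nat.cast_mul,
        Nat.card_eq_fintype_card]
    rw [hbudget]
    calc ∑ χ ∈ hfinS.toFinset, (χ 1).re ^ s
        ≤ ∑ χ ∈ hfinS.toFinset, K * ((χ 1).re * (∑ h : H, χ h).re) := Finset.sum_le_sum hterm
      _ = K * ∑ χ ∈ hfinS.toFinset, (χ 1).re * (∑ h : H, χ h).re := by rw [Finset.mul_sum]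
      _ ≤ K * ∑ χ ∈ hfinI.toFinset, (χ 1).re * (∑ h : H, χ h).re :=
          mul_le_mul_of_nonneg_left (Finset.sum_le_sum_of_subset_of_nonneg hsub hnonneg) hK0
      _ = ((P.index : ℝ) * Real.sqrt (Z.relIndex P : ℝ)) ^ (s - 2) *
            ((P.index : ℝ) * (H.index : ℝ)) := by
          rw [hDsum, hGH, hK]
          field_simp
  -- B's counts
  have hp2 : (2 : ℝ) ≤ (p : ℝ) := by exact_mod_cast (Fact.out : p.Prime).two_le
  exact final_bound hkm hs hp2 hiP0 (Nat.cast_nonneg _) (Nat.cast_nonneg _) hbud hPi hHi hZi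

end Summit.MatrixMultiplication.MatrixMultiplication.Theorems.LieRankDesigns

end
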